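import Mathlib
import Literature.Probability.RandomPlanarGeometry.ConformalWelding
import Summits.CriticalPhenomena.SAWScalingLimit.Theorems.SAWLoopFugacityFlowAvoidancePassageCrosscutSides

/-!
# Welding rigidity, II: the chord as a cross-cut and the banks as Jordan domains

Support file for item `stmt-CriticalPhenomena-4505` (`WeldingRigidity`, route
`SAWWeldingIdentification`).

A simple chord `γ` of the Dobrushin domain `(Ω; a, b) = Q.chord 0 2` of a conformal rectangle
`Q = (Ω; a, c_L, b, c_R)` (the route's five-clause hypothesis: simple, from `a` to `b`, in `Ω̄`,
meeting `∂Ω` only at `a, b`) is a cross-cut of the Jordan domain `Ω` (`chord_facts`). By Newman's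
cross-cut theorem (PROVED in the tree, `Newman1939_crosscut_holds`, packaged as Jordan domains by
`AvoidancePassage.exists_jordan_sides`) `Ω ∖ γ` has exactly two sides; the route's eight-clause
bank hypothesis (`L ∪ R = Ω ∖ γ`, disjoint open connected, `c_L ∈ L̄`, `c_R ∈ R̄`) forces
`{L, R}` to be these sides (`banks_eq_sides`), so `L` and `R` are carriers of Jordan domains with
frontiers `γ ∪ A_L` and `γ ∪ A_R`, `A_L ∋ c_L` and `A_R ∋ c_R` the two arcs of `∂Ω` from `a` to
`b` (`exists_banks`). All folklore (Newman 1939, Ch. V §11). No new definitions.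
-/

noncomputable section

open Set Filter Metric Topology Complex

namespace Summit.CriticalPhenomena.SAWScalingLimit.Theorems.WeldingRigidity

open Literature.Probability.RandomPlanarGeometry

/-! ### The chord as a cross-cut, and the banks as Jordan domains -/

section Banks

open Literature.Topology.PlaneTopology (IsSimpleArc)

/-- A simple curve class is a simple arc (in the sense of `PlaneTopology.IsSimpleArc`) from its
source to its target: reparametrise an injective representative by `Set.projIcc`. [folklore] -/
theorem isSimpleArc_of_mem_simple {γ : CurveClass ℂ} (hγ : γ ∈ CurveClass.simple) :
    IsSimpleArc γ.range γ.source γ.target := by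
  obtain ⟨c, hc, rfl⟩ := hγ
  have h0 : Set.projIcc (0 : ℝ) 1 zero_le_one 0 = (0 : unitInterval) :=
    Subtype.ext (by simp)
  have h1 : Set.projIcc (0 : ℝ) 1 zero_le_one 1 = (1 : unitInterval) :=
    Subtype.ext (by simp)
  refine ⟨fun t => c (Set.projIcc 0 1 zero_le_one t), ?_, ?_, ?_, ?_, ?_⟩
  · exact (c.continuous.comp continuous_projIcc).continuousOn
  · intro s hs t ht hst
    have h := congrArg Subtype.val (hc hst)
    simpa [Set.projIcc_of_mem _ hs, Set.projIcc_of_mem _ ht] using h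
  · ext z
    constructor
    · rintro ⟨t, -, rfl⟩
      exact ⟨_, rfl⟩
    · rintro ⟨t, rfl⟩
      refine ⟨t.1, t.2, ?_⟩
      simp only [Set.projIcc_of_mem _ t.2, Subtype.coe_eta]
  · show c _ = c 0
    rw [h0]
  · show c _ = c 1
    rw [h1]

/-- A simple arc has a point other than its endpoints (the image of `1/2`). [folklore] -/
theorem isSimpleArc_diff_nonempty {G : Set ℂ} {a b : ℂ} (h : IsSimpleArc G a b) :
    (G \ {a, b}).Nonempty := by
  obtain ⟨f, -, hinj, hG, h0, h1⟩ := h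
  have hm : (1 / 2 : ℝ) ∈ Icc (0 : ℝ) 1 := ⟨by norm_num, by norm_num⟩
  refine ⟨f (1 / 2), ⟨hG ▸ mem_image_of_mem f hm, ?_⟩⟩
  rintro (h | h)
  · have := hinj hm (left_mem_Icc.2 zero_le_one) (h.trans h0.symm)
    norm_num at this
  · have := hinj hm (right_mem_Icc.2 zero_le_one) (h.trans h1.symm)
    norm_num at this

variable (Q : ConformalRectangle)

/-- Marked points of a conformal rectangle are not in the (open) domain. [folklore] -/
theorem pt_notMem_carrier (i : Fin 4) : Q.pt i ∉ Q.carrier := by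
  have h := (Q.pt_mem_frontier i).2
  rwa [Q.isOpen.interior_eq] at h

variable {Q}

/-- **The chord as a cross-cut.** A simple chord `γ` of `(Ω; a, b)` (`a = Q.pt 0`, `b = Q.pt 2`)
is a simple arc from `a` to `b`, inside `Ω` off its endpoints, with a point other than `a, b`;
its trace meets `Ω` exactly off `{a, b}`. [folklore] -/
theorem chord_facts {γ : CurveClass ℂ}
    (hγ : γ ∈ CurveClass.simple ∧ γ.source = Q.pt 0 ∧ γ.target = Q.pt 2 ∧
      γ.range ⊆ closure Q.carrier ∧ γ.range ∩ frontier Q.carrier ⊆ {Q.pt 0, Q.pt 2}) :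
    IsSimpleArc γ.range (Q.pt 0) (Q.pt 2) ∧ γ.range \ {Q.pt 0, Q.pt 2} ⊆ Q.carrier ∧
      (γ.range \ {Q.pt 0, Q.pt 2}).Nonempty ∧ γ.range ∩ Q.carrier = γ.range \ {Q.pt 0, Q.pt 2} ∧
      Q.pt 0 ∈ γ.range ∧ Q.pt 2 ∈ γ.range := by
  obtain ⟨hs, h0, h2, -, -⟩ := id hγ
  have harc : IsSimpleArc γ.range (Q.pt 0) (Q.pt 2) := by
    rw [← h0, ← h2]
    exact isSimpleArc_of_mem_simple hs
  have hγ' : (Q.chord 0 2 (by decide)).IsSimpleChord γ := hγ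
  have hdiff : γ.range \ {Q.pt 0, Q.pt 2} ⊆ Q.carrier := hγ'.range_diff_subset
  refine ⟨harc, hdiff, isSimpleArc_diff_nonempty harc, ?_, h0 ▸ γ.source_mem_range, h2 ▸ γ.target_mem_range⟩
  apply Subset.antisymm
  · rintro z ⟨hzγ, hzΩ⟩
    refine ⟨hzγ, ?_⟩
    rintro (rfl | rfl)
    · exact pt_notMem_carrier Q 0 hzΩ
    · exact pt_notMem_carrier Q 2 hzΩ
  · exact fun z hz => ⟨hz.1, hdiff hz⟩

/-- A nonempty set disjoint from `T` is not contained in `T`. [folklore] -/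
theorem not_subset_of_disjoint {S T : Set ℂ} (hS : S.Nonempty) (hST : Disjoint S T) :
    ¬ S ⊆ T := fun h => by
  obtain ⟨x, hx⟩ := hS
  exact Set.disjoint_left.1 hST hx (h hx)

/-- **Identification of the banks with Newman's two sides.** If `L, R` (disjoint, open,
connected) cover `Ω ∖ γ` and so do the two sides `U₁, U₂` of the cross-cut `γ`, then
`{L, R} = {U₁, U₂}`. [folklore] -/
theorem banks_eq_sides {L R U₁ U₂ S : Set ℂ} (hLR : L ∪ R = S) (hLRd : Disjoint L R)
    (hLo : IsOpen L) (hRo : IsOpen R) (hLc : IsConnected L) (hRc : IsConnected R)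
    (hU : U₁ ∪ U₂ = S) (hUd : Disjoint U₁ U₂) (h1o : IsOpen U₁) (h2o : IsOpen U₂)
    (h1c : IsConnected U₁) (h2c : IsConnected U₂) :
    (L = U₁ ∧ R = U₂) ∨ (L = U₂ ∧ R = U₁) := by
  have hL : L ⊆ U₁ ∨ L ⊆ U₂ :=
    hLc.isPreconnected.subset_or_subset h1o h2o hUd (by rw [hU, ← hLR]; exact subset_union_left)
  have hR : R ⊆ U₁ ∨ R ⊆ U₂ :=
    hRc.isPreconnected.subset_or_subset h1o h2o hUd (by rw [hU, ← hLR]; exact subset_union_right)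
  have h1 : U₁ ⊆ L ∨ U₁ ⊆ R :=
    h1c.isPreconnected.subset_or_subset hLo hRo hLRd (by rw [hLR, ← hU]; exact subset_union_left)
  have h2 : U₂ ⊆ L ∨ U₂ ⊆ R :=
    h2c.isPreconnected.subset_or_subset hLo hRo hLRd (by rw [hLR, ← hU]; exact subset_union_right)
  rcases hL with hL | hL
  · left
    have hL' : L = U₁ := by
      refine hL.antisymm (h1.resolve_right fun h => ?_)
      exact not_subset_of_disjoint hLc.nonempty hLRd (hL.trans h)
    subst hL'
    refine ⟨rfl, ?_⟩
    have hR' : R ⊆ U₂ := hR.resolve_left fun h =>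
      not_subset_of_disjoint hRc.nonempty hLRd.symm h
    refine hR'.antisymm (h2.resolve_left fun h => ?_)
    exact not_subset_of_disjoint h2c.nonempty hUd.symm h
  · right
    have hL' : L = U₂ := by
      refine hL.antisymm (h2.resolve_right fun h => ?_)
      exact not_subset_of_disjoint hLc.nonempty hLRd (hL.trans h)
    subst hL'
    refine ⟨rfl, ?_⟩
    have hR' : R ⊆ U₁ := hR.resolve_right fun h =>
      not_subset_of_disjoint hRc.nonempty hLRd.symm h
    refine hR'.antisymm (h1.resolve_left fun h => ?_)
    exact not_subset_of_disjoint h1c.nonempty hUd h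

/-- **The auxiliary marks sit on the right arcs.** If the frontier of the bank `L ⊆ Ω` is
`γ ∪ A_L` and that of `R ⊆ Ω` is `γ ∪ A_R`, the two arcs meeting exactly in `{a, b}`, then
`c_L = Q.pt 1 ∈ closure L` lies on `A_L` and off `A_R`, and symmetrically for `c_R = Q.pt 3`.
[folklore] -/
theorem marks_mem_arcs {γ : CurveClass ℂ} {L R AL AR : Set ℂ}
    (hγfr : γ.range ∩ frontier Q.carrier ⊆ {Q.pt 0, Q.pt 2}) (hLΩ : L ⊆ Q.carrier)
    (hRΩ : R ⊆ Q.carrier) (hcL : Q.pt 1 ∈ closure L) (hcR : Q.pt 3 ∈ closure R)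
    (hfL : frontier L = γ.range ∪ AL) (hfR : frontier R = γ.range ∪ AR)
    (hAi : AL ∩ AR = {Q.pt 0, Q.pt 2}) :
    Q.pt 1 ∈ AL ∧ Q.pt 1 ∉ AR ∧ Q.pt 3 ∈ AR ∧ Q.pt 3 ∉ AL := by
  have h10 : Q.pt 1 ∉ ({Q.pt 0, Q.pt 2} : Set ℂ) := by
    rintro (h | h)
    · exact absurd (Q.pt_injective h) (by decide)
    · exact absurd (Q.pt_injective h) (by decide)
  have h30 : Q.pt 3 ∉ ({Q.pt 0, Q.pt 2} : Set ℂ) := by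
    rintro (h | h)
    · exact absurd (Q.pt_injective h) (by decide)
    · exact absurd (Q.pt_injective h) (by decide)
  have hγ1 : Q.pt 1 ∉ γ.range := fun h => h10 (hγfr ⟨h, Q.pt_mem_frontier 1⟩)
  have hγ3 : Q.pt 3 ∉ γ.range := fun h => h30 (hγfr ⟨h, Q.pt_mem_frontier 3⟩)
  have h1 : Q.pt 1 ∈ AL := by
    rw [closure_eq_self_union_frontier, hfL] at hcL
    rcases hcL with h | h | h
    · exact absurd (hLΩ h) (pt_notMem_carrier Q 1)
    · exact absurd h hγ1
    · exact h
  have h3 : Q.pt 3 ∈ AR := by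
    rw [closure_eq_self_union_frontier, hfR] at hcR
    rcases hcR with h | h | h
    · exact absurd (hRΩ h) (pt_notMem_carrier Q 3)
    · exact absurd h hγ3
    · exact h
  refine ⟨h1, fun h => h10 (hAi ▸ ⟨h1, h⟩), h3, fun h => h30 (hAi ▸ ⟨h, h3⟩)⟩

/-- **The banks of a simple chord are Jordan domains** (Newman's cross-cut theorem, PROVED in the
tree, packaged by `AvoidancePassage.exists_jordan_sides`): given the route's eight-clause bank
hypothesis, `L` and `R` are the carriers of Jordan domains with frontiers `γ ∪ A_L`, `γ ∪ A_R`,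
where `A_L ∋ c_L`, `A_R ∋ c_R` are the two arcs of `∂Ω` from `a` to `b`.
[cite: Newman1939, Ch. V §11, Thms. 11·7 and 11·8, pp. 94–95] -/
theorem exists_banks {γ : CurveClass ℂ} {L R : Set ℂ}
    (hγ : γ ∈ CurveClass.simple ∧ γ.source = Q.pt 0 ∧ γ.target = Q.pt 2 ∧
      γ.range ⊆ closure Q.carrier ∧ γ.range ∩ frontier Q.carrier ⊆ {Q.pt 0, Q.pt 2})
    (hb : L ∪ R = Q.carrier \ γ.range ∧ Disjoint L R ∧ IsOpen L ∧ IsOpen R ∧ IsConnected L ∧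
      IsConnected R ∧ Q.pt 1 ∈ closure L ∧ Q.pt 3 ∈ closure R) :
    ∃ (JL JR : JordanDomain) (AL AR : Set ℂ), JL.carrier = L ∧ JR.carrier = R ∧
      frontier L = γ.range ∪ AL ∧ frontier R = γ.range ∪ AR ∧
      IsSimpleArc AL (Q.pt 0) (Q.pt 2) ∧ IsSimpleArc AR (Q.pt 0) (Q.pt 2) ∧
      AL ∪ AR = frontier Q.carrier ∧ AL ∩ AR = {Q.pt 0, Q.pt 2} ∧
      Q.pt 1 ∈ AL ∧ Q.pt 1 ∉ AR ∧ Q.pt 3 ∈ AR ∧ Q.pt 3 ∉ AL := by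
  obtain ⟨harc, hdiff, -, -, -, -⟩ := chord_facts hγ
  obtain ⟨J₁, J₂, A₁, A₂, hdisj, hunion, hf1, hf2, hA1, hA2, hAu, hAi, -, -⟩ :=
    AvoidancePassage.exists_jordan_sides Q.toJordanDomain harc (Q.pt_mem_frontier 0)
      (Q.pt_mem_frontier 2) hdiff
  obtain ⟨hLR, hLRd, hLo, hRo, hLc, hRc, hcL, hcR⟩ := hb
  have hLΩ : L ⊆ Q.carrier := fun z hz => (hLR.le (Or.inl hz)).1
  have hRΩ : R ⊆ Q.carrier := fun z hz => (hLR.le (Or.inr hz)).1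
  rcases banks_eq_sides hLR hLRd hLo hRo hLc hRc hunion hdisj J₁.isOpen J₂.isOpen J₁.isConnected
    J₂.isConnected with ⟨rfl, rfl⟩ | ⟨rfl, rfl⟩
  · obtain ⟨h1, h1', h3, h3'⟩ := marks_mem_arcs hγ.2.2.2.2 hLΩ hRΩ hcL hcR hf1 hf2 hAi
    exact ⟨J₁, J₂, A₁, A₂, rfl, rfl, hf1, hf2, hA1, hA2, hAu, hAi, h1, h1', h3, h3'⟩
  · have hAi' : A₂ ∩ A₁ = {Q.pt 0, Q.pt 2} := by rw [inter_comm, hAi]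
    obtain ⟨h1, h1', h3, h3'⟩ := marks_mem_arcs hγ.2.2.2.2 hLΩ hRΩ hcL hcR hf2 hf1 hAi'
    exact ⟨J₂, J₁, A₂, A₁, rfl, rfl, hf2, hf1, hA2, hA1, by rw [union_comm, hAu], hAi', h1, h1',
      h3, h3'⟩

end Banks

end Summit.CriticalPhenomena.SAWScalingLimit.Theorems.WeldingRigidity
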